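import Summits.Ventures.PercRepro.C025ProfileOneFlatThin

/-!
# THE SECOND ROW OF THE UNIFORM ONE-FLAT FAMILY AT EVERY `τ`, IN TYPE FORM (night-3 g24)

`proofs/NIGHT3-G24-ONEFLAT.md` §8.  Members of `T_r(U_{s,k} ⊕ U_{m,m})` by their fat part size `i` (`c_i = min(i,s)`, free part
`q − c_i`, count `C(k,i)·C(m,q−c_i)`); the complement has rank `min(r, s + σ_i + m − q)` with `σ_i := min(k−i,s) + min(i,s) − s`, so the
weight is `r/(q+1)` if `s + σ_i + m ≥ r + q`, `1` if `s + σ_i + m + 1 = r + q`, `0` otherwise.  THE TYPE INEQUALITY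
`Σ_i C(k,i)·C(m,q−c_i)·[c_i ≤ q]·w_i ≤ Σ_i C(k,i)·C(m,r−1−c_i)` (`type_ineq`) for `r + q > s + m` (`τ ≥ 1`): the weight-1 types are
matched exactly by complementation (`i ↦ k − i`, `complement_terms`), the weight-`r/(q+1)` types are the window `[τ, k−τ]`, whose
contribution regrouped by `c = min(i,s)` is the trimmed sum of `trimmed_nonneg`, and the remaining supply is dropped.
No `def`, no `instance`, no notation.  Axioms: standard.
-/

namespace PercRepro

open Finset

namespace OneFlat

/-- The complementation identity on the weight-1 types: for `min(k−i,s) + min(i,s) = s + τ − 1` and `m + s + τ = r + q`,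
`[min(i,s) ≤ q]·C(m, q − min(i,s)) = C(m, r − 1 − min(k−i,s))`. -/
theorem complement_term {s k r q m τ i : ℕ} (hm : m + s + τ = r + q) (hsr : s + 1 ≤ r)
    (hσ : min (k - i) s + min i s = s + τ - 1) (hτ : 1 ≤ τ) :
    (if min i s ≤ q then (m.choose (q - min i s) : ℚ) else 0) = (m.choose (r - 1 - min (k - i) s) : ℚ) := by
  by_cases hc : min i s ≤ q
  · rw [if_pos hc]
    congr 1
    exact Nat.choose_symm_of_eq_add (by omega)
  · rw [if_neg hc]
    push Not at hc
    exact_mod_cast (Nat.choose_eq_zero_of_lt (by omega)).symm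

/-- Regrouping the window `[τ, k−τ]` by `c = min(i, s)`: for `τ ≤ s`, `s + τ ≤ k`,
`Σ_{i ∈ Ico τ (k−τ+1)} C(k,i)·f(min i s) = Σ_{c ∈ Ico τ (s+1)} V_c·f(c)` with `V_c = C(k,c)` (`c < s`), `V_s = Σ_{i ∈ Ico s (k−τ+1)} C(k,i)`. -/
theorem regroup_window (k s τ : ℕ) (hτs : τ ≤ s) (hk : s + τ ≤ k) (f : ℕ → ℚ) :
    ∑ i ∈ Ico τ (k - τ + 1), (k.choose i : ℚ) * f (min i s)
      = ∑ c ∈ Ico τ (s + 1), (if c < s then (k.choose c : ℚ) else ∑ i ∈ Ico s (k - τ + 1), (k.choose i : ℚ)) * f c := by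
  -- split the window at `s`
  have hsplit : Ico τ (k - τ + 1) = Ico τ s ∪ Ico s (k - τ + 1) := (Ico_union_Ico_eq_Ico (by omega) (by omega)).symm
  have hdisj : Disjoint (Ico τ s) (Ico s (k - τ + 1)) := Ico_disjoint_Ico_consecutive _ _ _
  rw [hsplit, sum_union hdisj]
  have hright : Ico τ (s + 1) = Ico τ s ∪ {s} := by
    ext c; simp only [mem_union, mem_Ico, mem_singleton]; omega
  have hdisj' : Disjoint (Ico τ s) {s} := by
    rw [disjoint_singleton_right, mem_Ico]; omega
  rw [hright, sum_union hdisj', sum_singleton, if_neg (lt_irrefl s)]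
  congr 1
  · apply sum_congr rfl
    intro i hi
    rw [mem_Ico] at hi
    rw [min_eq_left (by omega), if_pos hi.2]
  · rw [sum_mul]
    apply sum_congr rfl
    intro i hi
    rw [mem_Ico] at hi
    rw [min_eq_right hi.1]

/-- **THE TYPE INEQUALITY AT `τ ≥ 1`**: for `1 ≤ s`, `s ≤ k`, `m + s + τ = r + q` with `1 ≤ τ`, `s + 1 ≤ r`, `r ≤ s + m`, `q + 2 ≤ r`:
`Σ_{i ≤ k} C(k,i)·[min(i,s) ≤ q]·C(m, q − min(i,s))·w_i ≤ Σ_{i ≤ k} C(k,i)·C(m, r − 1 − min(i,s))`, where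
`w_i = r/(q+1)` if `τ ≤ σ_i`, `1` if `σ_i + 1 = τ`, `0` otherwise, `σ_i = min(k−i,s) + min(i,s) − s`. -/
theorem type_ineq {s k r q m τ : ℕ} (hs : 1 ≤ s) (hsk : s ≤ k) (hm : m + s + τ = r + q) (hτ : 1 ≤ τ)
    (hsr : s + 1 ≤ r) (hrm : r ≤ s + m) (hq : q + 2 ≤ r) :
    ∑ i ∈ range (k + 1), (k.choose i : ℚ) * (if min i s ≤ q then (m.choose (q - min i s) : ℚ) else 0) *
        (if τ ≤ min (k - i) s + min i s - s then (r : ℚ) / ((q : ℚ) + 1)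
          else if min (k - i) s + min i s - s + 1 = τ then 1 else 0)
      ≤ ∑ i ∈ range (k + 1), (k.choose i : ℚ) * (m.choose (r - 1 - min i s) : ℚ) := by
  -- the three classes of types
  set P : ℕ → ℚ := fun i => if min i s ≤ q then (m.choose (q - min i s) : ℚ) else 0 with hP
  set S : ℕ → ℚ := fun i => (m.choose (r - 1 - min i s) : ℚ) with hS
  have hσ : ∀ i, i ≤ k → s ≤ min (k - i) s + min i s := by
    intro i hi
    rcases le_total i s with h | h
    · rcases le_total (k - i) s with h' | h'
      · rw [min_eq_left h', min_eq_left h]; omega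
      · rw [min_eq_right h']; omega
    · rw [min_eq_right h]; omega
  -- (1) the weight-1 class: members = supply by the reflection `i ↦ k − i`
  have hone : ∑ i ∈ range (k + 1), (if min (k - i) s + min i s - s + 1 = τ then (k.choose i : ℚ) * P i else 0)
      = ∑ i ∈ range (k + 1), (if min (k - i) s + min i s - s + 1 = τ then (k.choose i : ℚ) * S i else 0) := by
    rw [← sum_range_reflect (fun i => if min (k - i) s + min i s - s + 1 = τ then (k.choose i : ℚ) * S i else 0) (k + 1)]
    apply sum_congr rfl
    intro i hi
    rw [mem_range] at hi
    rw [show k + 1 - 1 - i = k - i by omega, show k - (k - i) = i by omega, add_comm (min i s) (min (k - i) s),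
      Nat.choose_symm (by omega : i ≤ k)]
    by_cases hw : min (k - i) s + min i s - s + 1 = τ
    · rw [if_pos hw, if_pos hw]
      congr 1
      simp only [hP, hS]
      exact complement_term hm hsr (by have := hσ i (by omega); omega) hτ
    · rw [if_neg hw, if_neg hw]
  -- (2) the weight-`r/(q+1)` class is the window `[τ, k−τ]`, and its trimmed sum is `≥ 0`
  have hwin : ∀ i, i ≤ k → (τ ≤ min (k - i) s + min i s - s ↔ (τ ≤ i ∧ i ≤ k - τ ∧ τ ≤ s ∧ s + τ ≤ k)) := by
    intro i hi
    rcases le_total i s with h | h <;> rcases le_total (k - i) s with h' | h'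
    · rw [min_eq_left h', min_eq_left h]; omega
    · rw [min_eq_right h', min_eq_left h]; omega
    · rw [min_eq_left h', min_eq_right h]; omega
    · rw [min_eq_right h', min_eq_right h]; omega
  have hbig : (r : ℚ) / ((q : ℚ) + 1) * ∑ i ∈ range (k + 1), (if τ ≤ min (k - i) s + min i s - s then (k.choose i : ℚ) * P i else 0)
      ≤ ∑ i ∈ range (k + 1), (if τ ≤ min (k - i) s + min i s - s then (k.choose i : ℚ) * S i else 0) := by
    by_cases hwindow : τ ≤ s ∧ s + τ ≤ k
    · -- the class is exactly `Ico τ (k − τ + 1)`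
      have hfilt : ∀ (g : ℕ → ℚ), ∑ i ∈ range (k + 1), (if τ ≤ min (k - i) s + min i s - s then g i else 0)
          = ∑ i ∈ Ico τ (k - τ + 1), g i := by
        intro g
        rw [← sum_filter]
        apply sum_congr _ (fun _ _ => rfl)
        ext i
        simp only [mem_filter, mem_range, mem_Ico]
        constructor
        · rintro ⟨hi, hw⟩
          have := (hwin i (by omega)).1 hw
          omega
        · rintro ⟨h1, h2⟩
          refine ⟨by omega, ?_⟩
          exact (hwin i (by omega)).2 ⟨h1, by omega, hwindow.1, hwindow.2⟩
      rw [hfilt, hfilt]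
      have hpos : (0 : ℚ) < (q : ℚ) + 1 := by positivity
      -- `((q+1)·Σ S − r·Σ P) ≥ 0` is the trimmed inequality, regrouped by `c = min(i,s)`
      have key := trimmed_nonneg (s := s) (τ := τ) (k := k) (r := r) (q := q) (m := m) hτ hwindow.1 hwindow.2 hm hsr hrm hq
      have hre := regroup_window k s τ hwindow.1 hwindow.2
        (fun c => ((q : ℚ) + 1) * (m.choose (r - 1 - c) : ℚ) - (r : ℚ) * (if c ≤ q then (m.choose (q - c) : ℚ) else 0))
      rw [← hre] at key
      have : ∑ i ∈ Ico τ (k - τ + 1), (k.choose i : ℚ) *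
          (((q : ℚ) + 1) * (m.choose (r - 1 - min i s) : ℚ) - (r : ℚ) * (if min i s ≤ q then (m.choose (q - min i s) : ℚ) else 0))
          = ((q : ℚ) + 1) * ∑ i ∈ Ico τ (k - τ + 1), (k.choose i : ℚ) * S i
            - (r : ℚ) * ∑ i ∈ Ico τ (k - τ + 1), (k.choose i : ℚ) * P i := by
        rw [mul_sum, mul_sum, ← sum_sub_distrib]
        apply sum_congr rfl; intro i _; simp only [hP, hS]; ring
      rw [this] at key
      rw [div_mul_eq_mul_div, div_le_iff₀ hpos]
      linarith [key]
    · -- no type of weight `r/(q+1)`: both sides vanish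
      have hnone : ∀ i ∈ range (k + 1), ¬ (τ ≤ min (k - i) s + min i s - s) := by
        intro i hi hw
        rw [mem_range] at hi
        have := (hwin i (by omega)).1 hw
        exact hwindow ⟨this.2.2.1, this.2.2.2⟩
      rw [sum_congr rfl (fun i hi => if_neg (hnone i hi)), sum_congr rfl (fun i hi => if_neg (hnone i hi))]
      simp
  -- (3) assemble: split the member sum into the two classes, bound each, and add back the dropped supply
  have hmem : ∑ i ∈ range (k + 1), (k.choose i : ℚ) * P i *
        (if τ ≤ min (k - i) s + min i s - s then (r : ℚ) / ((q : ℚ) + 1)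
          else if min (k - i) s + min i s - s + 1 = τ then 1 else 0)
      = (r : ℚ) / ((q : ℚ) + 1) * ∑ i ∈ range (k + 1), (if τ ≤ min (k - i) s + min i s - s then (k.choose i : ℚ) * P i else 0)
        + ∑ i ∈ range (k + 1), (if min (k - i) s + min i s - s + 1 = τ then (k.choose i : ℚ) * P i else 0) := by
    rw [mul_sum, ← sum_add_distrib]
    apply sum_congr rfl
    intro i _
    by_cases h1 : τ ≤ min (k - i) s + min i s - s
    · rw [if_pos h1, if_pos h1, if_neg (by omega)]; ring
    · rw [if_neg h1, if_neg h1]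
      by_cases h2 : min (k - i) s + min i s - s + 1 = τ
      · rw [if_pos h2, if_pos h2]; ring
      · rw [if_neg h2, if_neg h2]; ring
  have hsup : ∑ i ∈ range (k + 1), (if τ ≤ min (k - i) s + min i s - s then (k.choose i : ℚ) * S i else 0)
        + ∑ i ∈ range (k + 1), (if min (k - i) s + min i s - s + 1 = τ then (k.choose i : ℚ) * S i else 0)
      ≤ ∑ i ∈ range (k + 1), (k.choose i : ℚ) * S i := by
    rw [← sum_add_distrib]
    apply sum_le_sum
    intro i _
    have hSnn : (0 : ℚ) ≤ (k.choose i : ℚ) * S i := by simp only [hS]; positivity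
    by_cases h1 : τ ≤ min (k - i) s + min i s - s
    · rw [if_pos h1, if_neg (by omega)]; linarith
    · rw [if_neg h1]
      by_cases h2 : min (k - i) s + min i s - s + 1 = τ
      · rw [if_pos h2]; linarith
      · rw [if_neg h2]; linarith
  have h1 := hmem
  have h2 := hbig
  have h3 := hone
  have h4 := hsup
  linarith [h1, h2, h3, h4]

end OneFlat

end PercRepro
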